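import Literature.AlgebraicGeometry.AbelianSchemes.AbelianSchemeDualPair
import Literature.AlgebraicGeometry.AbelianVarieties.PoincareSheafSlicesPoints
import Literature.AlgebraicGeometry.AbelianVarieties.PoincareSheafSeesawFibre
import Literature.AlgebraicGeometry.AbelianSchemes.RigidifiedLineBundleSliceHomogeneous
import Literature.AlgebraicGeometry.AbelianSchemes.ModuleSliceOfBaseChange
import Literature.AlgebraicGeometry.Motives.SeesawTrivialOnRationalSlices
import Literature.AlgebraicGeometry.Modules.CechClassClassPullback
import Literature.AlgebraicGeometry.AbelianVarieties.PoincareSheafOfPrincipal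
import Literature.AlgebraicGeometry.AbelianVarieties.UnitPointSlices
import Literature.AlgebraicGeometry.Modules.ExtensionContraction
import Literature.AlgebraicGeometry.Motives.GeometricallyIntegralAlgClosed
import Literature.AlgebraicGeometry.Motives.RationalPointSlices
import Literature.AlgebraicGeometry.Motives.SeesawGrauertCubeFactsHoldsProofs
import Literature.AlgebraicGeometry.Motives.SemicontinuityGrothendieckComplexProofs
import Literature.AlgebraicGeometry.Motives.ClosedGraphMorphismUnique
import Literature.AlgebraicGeometry.Motives.AbelianVarietyPhiThetaFibres
import Literature.AlgebraicGeometry.Motives.AbelianVarietyPicZeroOfAmple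
import Literature.AlgebraicGeometry.Motives.BijectiveMorphismIsoGeneral
import HarnessLib

/-!
# The normalised Poincaré sheaf of `Â = A/K(Θ)` is UNIVERSAL over normal bases (Mumford §8/§10, Milne I §8, over `ℂ`)

Layer `Literature/AlgebraicGeometry/Motives` ∩ `AbelianVarieties`, namespace `Literature.AlgebraicGeometry.Motives.AbelianVariety`.
KERNEL ONLY: one theorem (+ a private `Ȟ¹` functoriality lemma); no definition, no named fact, no instance, no `sorry`.

**`exists_unique_classify_of_normal`** — for a complex abelian variety `A₀` with an ample divisor `Θ`, its dual
`Â = A₀/K(Θ)` (`A₀.dualOf Θ hΘ`), and ANY line bundle `𝒫` on `A₀ × Â` with `(1 × φ_Θ)^*𝒫 ≅ Λ(𝒪(Θ))` and `𝒫|_{{0} × Â} ≅ 𝒪`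
(the three clauses of ★ `exists_poincareSheaf_normalised`): every rigidified line bundle `ℒ` on `A₀ × T` lying fibrewise in
`Pic⁰` (`RigidifiedLineBundle`, `FibrewisePicZero` of ★ `AbelianSchemes/AbelianSchemeDualPair`), for `T` INTEGRAL, NORMAL and
locally of finite type over `ℂ`, is `(1 × g)^*𝒫` for a UNIQUE `g : T → Â` over `ℂ` — literally the `universal` clause of the
tree's `AbelianSchemeOver.DualPair` for `A := ofAbelianVariety A₀`, `hat := ofAbelianVariety Â`, restricted to such `T`
([MumfordAV1970] §8 p. 78 definition of the dual + §10 p. 89 (graph/seesaw argument) + §13 p. 125; [MilneAV2008] I §8 Thm. 8.9).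
The general-`T` clause (all schemes `T`) is NOT proved here (it needs the Artin/representability road, [GW II] 27.117).

Proof = the seesaw–graph assembly of the cell's CENSUS-R3a, every step a ★ leaf:
S1 the seesaw sheaf `𝓕 := q₁₂^*ℒ ⊗ (q₁₃^*𝒫)^∨` on `A₀ × (T × Â)` is `𝒪(D)` (★ `hasRank_seesawSheaf`, ★ `exists_iso_lineBundle_toUnitCocycle`);
S2 `Γ := trivialLocus D ⊆ T × Â` is closed (★ `seesaw_isClosed_trivialLocus_holds`, [GW II] 24.66);
S3 its `ℂ`-points are read on slices (★ `mem_trivialLocus_iff_classPullback_slice_linEquiv_zero`, ★ `detClass_pullback_sliceAt_seesawSheaf`,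
★ `RationalPointSlices`);
S4 `Γ(ℂ)` is the graph of `x ↦ φ_Θ(a_x)`, `[ℒ|_{A × {x}}] = [t_{a_x}^*Θ − Θ]` (Mumford §8 Thm. 1 over `ℂ`: ★ `exists_detClass_eq_detClass_pullback_sliceAt`
fed by ★ `isHomogeneous_sliceAt_of_fibrewisePicZero`; injectivity ★ `eq_of_detClass_pullback_sliceAt_eq`);
S5+S7 a closed graph over a normal variety is the graph of a unique morphism (ZMT road, ★ `existsUnique_hom_forall_comp_eq_of_isClosed`);
S6 `(1 × ψ)^*𝒫 ≅ ℒ`: the class `[ℒ]·[(1 × ψ)^*𝒫]⁻¹` dies on every rational slice (★ `detClass_pullback_pullback_slice_eq`) and on the unit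
section (`ℒ.rigid`, `𝒫|_{{0} × Â} ≅ 𝒪`, ★ `UnitPointSlices`), hence is trivial (★ `linEquiv_zero_of_forall_slice_of_rigidified` — seesaw
+ Jacobson); S7′ conversely an isomorphism `(1 × ψ)^*𝒫 ≅ ℒ` forces `ψ(x) = φ_Θ(a_x)` on `ℂ`-points.
Cell `hodgecm-mathlib`, J0b road (i) / memo §3 N0 / U-DAG U-a3 at the normal-`T` stage (B-p02 g8, R37); inputs by B-p07, B-p09, B-p21.

## References
* [MumfordAV1970] D. Mumford, *Abelian Varieties* (1970), §8 (pp. 74–80), §10 (p. 89), §13 (p. 125).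
* [MilneAV2008] J. S. Milne, *Abelian Varieties* (2008), I §8 (Thm. 8.9, Prop. 8.14).
* [GortzWedhorn2023] U. Görtz, T. Wedhorn, *Algebraic Geometry II* (2023), Thm. 24.66 (seesaw), 27.117.
-/

noncomputable section

universe u

open CategoryTheory CategoryTheory.Limits AlgebraicGeometry MonoidalCategory CartesianMonoidalCategory

namespace Literature.AlgebraicGeometry.Motives


namespace AbelianVariety

open Literature.AlgebraicGeometry.AbelianSchemes Literature.AlgebraicGeometry.AbelianVarieties
  Literature.AlgebraicGeometry.Modules

/-- `(f ≫ g)^* = f^* ∘ g^*` on `Ȟ¹(−, 𝒪^×)`. [folklore] -/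
private theorem cechPic_pullback_comp'' {X Y Z : Scheme.{u}} (f : X ⟶ Y) (g : Y ⟶ Z) (γ : CechPic Z) :
    CechPic.pullback (f ≫ g) γ = CechPic.pullback f (CechPic.pullback g γ) := by
  obtain ⟨c, rfl⟩ := CechPic.mk_surjective γ
  have hE := c.isFiniteLocallyFree_lineBundle
  rw [← c.detClass_lineBundle, ← detClass_pullback, ← detClass_pullback, ← detClass_pullback]
  exact detClass_eq_of_iso ((Scheme.Modules.pullbackComp f g).app (lineBundle c)).symm _ _

variable (A₀ : AbelianVariety ℂ) {Θ : CartierDivisor A₀.X.left} (hΘ : Θ.IsAmple)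

/-- **Universality of the normalised Poincaré sheaf over NORMAL bases** ([MumfordAV1970] §8 Thm. p. 78 / §10 p. 89;
[MilneAV2008] I §8 Thm. 8.9 with Prop. 8.14): for `𝒫` on `A × Â` (`Â = A/K(Θ)`) with `(1 × φ_Θ)^*𝒫 ≅ Λ(𝒪(Θ))` and
`𝒫|_{{0} × Â} ≅ 𝒪`, every rigidified line bundle `ℒ` on `A × T`, `T` integral normal locally of finite type over `ℂ`,
which lies fibrewise in `Pic⁰`, is `(1 × g)^*𝒫` for a unique `g : T → Â` over `ℂ` — the `universal` clause of the
tree's `DualPair` at such `T`. [cite: MumfordAV1970, §8 Theorem (p. 77) and §10 (p. 89)] [cite: MilneAV2008, I §8 Thm. 8.9 and Prop. 8.14] -/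
theorem exists_unique_classify_of_normal
    (P : (A₀.X ⊗ (A₀.dualOf Θ hΘ).X).left.Modules) [P.IsQuasicoherent] (hP1 : HasRank P 1)
    (eP : Nonempty ((Scheme.Modules.pullback (AbelianVariety.Hom.toSchemeHom (A₀.oneProdPhiTheta hΘ))).obj P ≅
      mumfordSheaf A₀ Θ))
    (hnorm : Nonempty ((Scheme.Modules.pullback (sliceZero A₀ (A₀.dualOf Θ hΘ)).left).obj P ≅
      unitModule (A₀.dualOf Θ hΘ).X.left))
    {T : Scheme.{0}} (f : T ⟶ Spec (.of ℂ)) [IsIntegral T] [LocallyOfFiniteType f]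
    (hTn : ∀ t : T, IsIntegrallyClosed (T.presheaf.stalk t))
    (ℒ : (AbelianSchemeOver.ofAbelianVariety A₀).RigidifiedLineBundle f) (hℒ : ℒ.FibrewisePicZero) :
    ∃! g : {g : T ⟶ (A₀.dualOf Θ hΘ).X.left // g ≫ (A₀.dualOf Θ hΘ).X.hom = f},
      Nonempty ((Scheme.Modules.pullback ((AbelianSchemeOver.ofAbelianVariety A₀).baseChangeToProd
        (AbelianSchemeOver.ofAbelianVariety (A₀.dualOf Θ hΘ)) f g.1 g.2)).obj P ≅ ℒ.L) := by
  -- the base as a `ℂ`-scheme and its instances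
  let T' : SchemeOver ℂ := Over.mk f
  haveI : IsIntegral T'.left := ‹IsIntegral T›
  haveI : LocallyOfFiniteType T'.hom := ‹LocallyOfFiniteType f›
  -- S1–S4 (+ S6/S7′): the seesaw graph `Γ ⊆ T × Â`, its `ℂ`-points, and «graph property ⟺ `(1 × ψ)^*𝒫 ≅ ℒ`»
  have hgraph : ∃ (Γ : Set ↥(T' ⊗ (A₀.dualOf Θ hΘ).X).left)
      (φ₀ : AlgPoints T' ℂ → AlgPoints (A₀.dualOf Θ hΘ).X ℂ),
      IsClosed Γ ∧
      (∀ (x : AlgPoints T' ℂ) (y : AlgPoints (A₀.dualOf Θ hΘ).X ℂ),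
        AlgPoints.pt (lift x y : AlgPoints (T' ⊗ (A₀.dualOf Θ hΘ).X) ℂ) ∈ Γ ↔ y = φ₀ x) ∧
      (∀ ψ : T' ⟶ (A₀.dualOf Θ hΘ).X,
        (∀ x : AlgPoints T' ℂ, x ≫ ψ = φ₀ x) ↔
          Nonempty ((Scheme.Modules.pullback ((AbelianSchemeOver.ofAbelianVariety A₀).baseChangeToProd
            (AbelianSchemeOver.ofAbelianVariety (A₀.dualOf Θ hΘ)) f ψ.left (Over.w ψ))).obj P ≅ ℒ.L)) := by
    -- notation
    haveI : GeometricallyIntegral T'.hom := geometricallyIntegral_of_isAlgClosed (k := ℂ) f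
    haveI : IsIntegral A₀.X.left := GeometricallyIntegral.isIntegral_of_subsingleton A₀.X.hom
    haveI : IsIntegral (A₀.dualOf Θ hΘ).X.left :=
      GeometricallyIntegral.isIntegral_of_subsingleton (A₀.dualOf Θ hΘ).X.hom
    haveI : IsIntegral (T' ⊗ (A₀.dualOf Θ hΘ).X).left :=
      GeometricallyIntegral.isIntegral_of_subsingleton (T' ⊗ (A₀.dualOf Θ hΘ).X).hom
    haveI : IsIntegral (A₀.X ⊗ (T' ⊗ (A₀.dualOf Θ hΘ).X)).left :=
      GeometricallyIntegral.isIntegral_of_subsingleton (A₀.X ⊗ (T' ⊗ (A₀.dualOf Θ hΘ).X)).hom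
    haveI : IsIntegral (A₀.X ⊗ T').left := GeometricallyIntegral.isIntegral_of_subsingleton (A₀.X ⊗ T').hom
    have hPff : IsFiniteLocallyFree P := HasRank.isFiniteLocallyFree' hP1
    -- S1: the seesaw sheaf `𝓕 := q₁₂^*ℒ ⊗ (q₁₃^*𝒫)^∨` on `A × (T × Â)` and its divisor
    have h𝓕1 : HasRank (tensorObj
        ((Scheme.Modules.pullback (A₀.X ◁ CartesianMonoidalCategory.fst T' (A₀.dualOf Θ hΘ).X).left).obj ℒ.L)
        (Modules.dual ((Scheme.Modules.pullback
          (A₀.X ◁ CartesianMonoidalCategory.snd T' (A₀.dualOf Θ hΘ).X).left).obj P))) 1 :=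
      hasRank_seesawSheaf (A := A₀.X) (T := T') (B := (A₀.dualOf Θ hΘ).X) (M := ℒ.L) (P := P) ℒ.hasRank_one hP1
    have h𝓕ff := HasRank.isFiniteLocallyFree' h𝓕1
    obtain ⟨D, ⟨φD⟩⟩ := exists_iso_lineBundle_toUnitCocycle h𝓕1
    have hD : detClass h𝓕ff = D.cechClass := detClass_eq_cechClass_of_iso φD h𝓕ff
    -- reading `g^*D ∼ 0` as `det (g^*𝓕) = 1`
    have hread : ∀ {Z : Scheme.{0}} [IsIntegral Z] (g : Z ⟶ (A₀.X ⊗ (T' ⊗ (A₀.dualOf Θ hΘ).X)).left),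
        (D.classPullback g).LinEquiv 0 ↔ detClass (h𝓕ff.pullback g) = 1 := by
      intro Z _ g
      rw [← CartierDivisor.cechClass_eq_iff_linEquiv, CartierDivisor.cechClass_zero,
        ← CartierDivisor.pullback_cechClass_eq_cechClass_classPullback, ← hD, ← detClass_pullback]
    -- S2: the graph `Γ` = trivial locus of `D` over `T × Â`, closed by the seesaw theorem
    let Γ : Set ↥(T' ⊗ (A₀.dualOf Θ hΘ).X).left :=
      CartierDivisor.trivialLocus A₀.X (T' ⊗ (A₀.dualOf Θ hΘ).X) D
    have hΓ : IsClosed Γ := seesaw_isClosed_trivialLocus_holds ℂ A₀.X (T' ⊗ (A₀.dualOf Θ hΘ).X) D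
    -- S4: `φ₀ x := φ_Θ(a_x)` with `[ℒ|_{A × {x}}] = [𝒫|_{A × {φ_Θ a_x}}]` ((R1a)_ℂ on the homogeneous slice)
    have hsl : ∀ x : AlgPoints T' ℂ, ∃ b : AlgPoints (A₀.dualOf Θ hΘ).X ℂ,
        detClass (HasRank.isFiniteLocallyFree' (AbelianSchemeOver.hasRank_sliceAt A₀ ℒ x)) =
          detClass (hPff.pullback (lift (𝟙 A₀.X) (toSpecOver A₀.X ≫ b)).left) := by
      intro x
      obtain ⟨a, ha⟩ := exists_detClass_eq_detClass_pullback_sliceAt A₀ hΘ hP1 eP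
        (AbelianSchemeOver.hasRank_sliceAt A₀ ℒ x) (AbelianSchemeOver.isHomogeneous_sliceAt_of_fibrewisePicZero A₀ ℒ hℒ x)
      exact ⟨AlgPoints.map (A₀.phiTheta Θ hΘ).hom.hom.hom a, ha⟩
    choose φ₀ hφ₀ using hsl
    -- S3: the `ℂ`-points of `Γ`
    have hΓφ : ∀ (x : AlgPoints T' ℂ) (y : AlgPoints (A₀.dualOf Θ hΘ).X ℂ),
        AlgPoints.pt (lift x y : AlgPoints (T' ⊗ (A₀.dualOf Θ hΘ).X) ℂ) ∈ Γ ↔ y = φ₀ x := by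
      intro x y
      obtain ⟨t₀, ht₀⟩ := exists_unitHom_left_eq (X := T' ⊗ (A₀.dualOf Θ hΘ).X) (K := ℂ) (lift x y)
      have hpt : AlgPoints.pt (X := T' ⊗ (A₀.dualOf Θ hΘ).X) (lift x y) = t₀.left.base (IsLocalRing.closedPoint ℂ) :=
        AlgPoints.pt_eq_base_of_left_eq (X := T' ⊗ (A₀.dualOf Θ hΘ).X) (lift x y) t₀ ht₀ _
      have key := CartierDivisor.mem_trivialLocus_iff_classPullback_slice_linEquiv_zero A₀.X
        (T' ⊗ (A₀.dualOf Θ hΘ).X) D t₀ (IsLocalRing.closedPoint ℂ)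
      have hsp := lift_id_toSpecOver_comp_left_eq_slice_left A₀.X (T := T' ⊗ (A₀.dualOf Θ hΘ).X)
        (lift x y) t₀ ht₀
      have hPa := detClass_pullback_sliceAt_seesawSheaf (A := A₀.X) (T := T') (B := (A₀.dualOf Θ hΘ).X)
        (M := ℒ.L) (P := P) ℒ.hasRank_one hP1 x y h𝓕ff
        (HasRank.isFiniteLocallyFree' (AbelianSchemeOver.hasRank_sliceAt A₀ ℒ x))
        (hPff.pullback (lift (𝟙 A₀.X) (toSpecOver A₀.X ≫ y)).left)
      rw [hpt]
      refine key.trans ?_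
      rw [← hsp, hread, hPa, mul_inv_eq_one, hφ₀ x]
      exact ⟨fun h => (eq_of_detClass_pullback_sliceAt_eq A₀ hΘ hP1 eP _ _ h).symm, fun h => by subst h; rfl⟩
    -- S6 + S7′
    have hiff : ∀ ψ : T' ⟶ (A₀.dualOf Θ hΘ).X, (∀ x : AlgPoints T' ℂ, x ≫ ψ = φ₀ x) ↔
        Nonempty ((Scheme.Modules.pullback ((AbelianSchemeOver.ofAbelianVariety A₀).baseChangeToProd
          (AbelianSchemeOver.ofAbelianVariety (A₀.dualOf Θ hΘ)) f ψ.left (Over.w ψ))).obj P ≅ ℒ.L) := by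
      intro ψ
      have hbc : (AbelianSchemeOver.ofAbelianVariety A₀).baseChangeToProd
          (AbelianSchemeOver.ofAbelianVariety (A₀.dualOf Θ hΘ)) f ψ.left (Over.w ψ) = (A₀.X ◁ ψ).left :=
        AbelianSchemeOver.baseChangeToProd_ofAbelianVariety_eq_whiskerLeft_left A₀ (A₀.dualOf Θ hΘ) ψ
      have hℒff : IsFiniteLocallyFree ℒ.L := HasRank.isFiniteLocallyFree' ℒ.hasRank_one
      -- the slice of `(1 × ψ)^*𝒫` at a `ℂ`-point `x` has the class of `𝒫|_{A × {ψ x}}`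
      have hkey : ∀ x : AlgPoints T' ℂ,
          detClass (hPff.pullback (lift (𝟙 A₀.X) (toSpecOver A₀.X ≫ (x ≫ ψ))).left) =
            CechPic.pullback (lift (𝟙 A₀.X) (toSpecOver A₀.X ≫ x)).left
              (CechPic.pullback (A₀.X ◁ ψ).left (detClass hPff)) := by
        intro x
        obtain ⟨t₀, ht₀⟩ := exists_unitHom_left_eq (X := T') (K := ℂ) x
        have ht' : (t₀ ≫ ψ).left = (x ≫ ψ).left := by
          rw [Over.comp_left, Over.comp_left]; exact congrArg (· ≫ ψ.left) ht₀
        rw [lift_id_toSpecOver_comp_left_eq_slice_left A₀.X (T := (A₀.dualOf Θ hΘ).X) (x ≫ ψ) (t₀ ≫ ψ) ht',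
          lift_id_toSpecOver_comp_left_eq_slice_left A₀.X (T := T') x t₀ ht₀,
          ← detClass_pullback_pullback_slice_eq A₀.X P hPff ψ t₀]
        rw [detClass_pullback _ (hPff.pullback (A₀.X ◁ ψ).left), detClass_pullback _ hPff]
      constructor
      · intro hψ
        -- S6: `c := [ℒ]·[(1 × ψ)^*𝒫]⁻¹ = [𝒪(D')]` on `A × T`; every rational slice and the unit section kill it
        have hN1 := hasRank_pullback ((AbelianSchemeOver.ofAbelianVariety A₀).baseChangeToProd
          (AbelianSchemeOver.ofAbelianVariety (A₀.dualOf Θ hΘ)) f ψ.left (Over.w ψ)) hP1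
        obtain ⟨D', hD'⟩ := CechPic.exists_cechClass_eq
          (@HDiv.hDiv (CechPic (A₀.X ⊗ T').left) (CechPic (A₀.X ⊗ T').left) (CechPic (A₀.X ⊗ T').left)
            instHDiv (detClass hℒff)
            (CechPic.pullback ((AbelianSchemeOver.ofAbelianVariety A₀).baseChangeToProd
              (AbelianSchemeOver.ofAbelianVariety (A₀.dualOf Θ hΘ)) f ψ.left (Over.w ψ)) (detClass hPff)))
        have hsl' : ∀ t₀ : 𝟙_ (SchemeOver ℂ) ⟶ T',
            (D'.classPullback ((ρ_ A₀.X).inv ≫ A₀.X ◁ t₀).left).LinEquiv 0 := by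
          intro t₀
          obtain ⟨x, hx⟩ := exists_algPoints_left_eq (X := T') (K := ℂ) t₀
          have e1 : CechPic.pullback (lift (𝟙 A₀.X) (toSpecOver A₀.X ≫ x)).left (detClass hℒff) =
              detClass (HasRank.isFiniteLocallyFree' (AbelianSchemeOver.hasRank_sliceAt A₀ ℒ x)) :=
            (detClass_pullback _ hℒff).symm
          rw [← CartierDivisor.cechClass_eq_iff_linEquiv, CartierDivisor.cechClass_zero,
            ← CartierDivisor.pullback_cechClass_eq_cechClass_classPullback, hD', map_div, div_eq_one,
            ← lift_id_toSpecOver_comp_left_eq_slice_left A₀.X (T := T') x t₀ hx.symm, e1, hφ₀ x, ← hψ x, hkey x,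
            hbc]
          try rfl
        have h0 : (D'.classPullback ((λ_ T').inv ≫ A₀.unitPoint 1 ▷ T').left).LinEquiv 0 := by
          -- `ℒ` is rigidified along `ε × 1_T`
          obtain ⟨er⟩ := ℒ.rigid
          have hs2 : ((AbelianSchemeOver.ofAbelianVariety A₀).baseChange f).unitSection =
              ((λ_ T').inv ≫ A₀.unitPoint 1 ▷ T').left := unitSection_baseChange_ofAbelianVariety A₀ T'
          have eu := (eqToIso (congrArg (fun k => (Scheme.Modules.pullback k).obj ℒ.L) hs2)).symm ≪≫ er
          have l1 : CechPic.pullback ((λ_ T').inv ≫ A₀.unitPoint 1 ▷ T').left (detClass hℒff) =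
              (1 : CechPic T'.left) :=
            (detClass_pullback _ hℒff).symm.trans
              ((detClass_eq_of_iso eu (hℒff.pullback _) isFiniteLocallyFree_unitModule).trans
                (detClass_unitModule_eq_one _))
          -- `(ε × 1_T) ≫ (1 × ψ) = ψ ≫ (0, id)` and `𝒫|_{{0} × Â} ≅ 𝒪`
          obtain ⟨en⟩ := hnorm
          have r1 : CechPic.pullback ((λ_ T').inv ≫ A₀.unitPoint 1 ▷ T').left
              (CechPic.pullback (A₀.X ◁ ψ).left (detClass hPff)) = 1 := by
            rw [← cechPic_pullback_comp'',
              leftUnitor_inv_comp_unitPoint_one_whiskerRight_comp_whiskerLeft_left A₀ (A₀.dualOf Θ hΘ) ψ,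
              cechPic_pullback_comp'', ← detClass_pullback _ hPff,
              detClass_eq_of_iso en (hPff.pullback _) isFiniteLocallyFree_unitModule, detClass_unitModule_eq_one,
              map_one]
          rw [← CartierDivisor.cechClass_eq_iff_linEquiv, CartierDivisor.cechClass_zero,
            ← CartierDivisor.pullback_cechClass_eq_cechClass_classPullback, hD', map_div, div_eq_one, hbc]
          exact l1.trans r1.symm
        have hD'0 : D'.LinEquiv 0 :=
          CartierDivisor.linEquiv_zero_of_forall_slice_of_rigidified A₀.X T' D' hsl' (A₀.unitPoint 1) h0
        have hc := ((CartierDivisor.cechClass_eq_iff_linEquiv D' 0).2 hD'0).trans CartierDivisor.cechClass_zero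
        rw [hD', div_eq_one] at hc
        refine (nonempty_iso_iff_detClass_eq hN1 ℒ.hasRank_one (hPff.pullback _) hℒff).2 ?_
        rw [detClass_pullback]
        exact hc.symm
      · rintro ⟨e⟩ x
        have hx1 := AbelianSchemeOver.hasRank_sliceAt A₀ ℒ x
        -- `[(1 × ψ)^*𝒫] = [ℒ]` in `Ȟ¹(A × T, 𝒪^×)`
        have hcl0 := detClass_eq_of_iso e (hPff.pullback _) hℒff
        rw [detClass_pullback] at hcl0
        have hcl : CechPic.pullback (A₀.X ◁ ψ).left (detClass hPff) = detClass hℒff := by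
          rw [← hbc]; exact hcl0
        -- slice at `x`: `[𝒫|_{A × {ψ x}}] = [ℒ|_{A × {x}}] = [𝒫|_{A × {φ₀ x}}]`
        have h1 : detClass (hPff.pullback (lift (𝟙 A₀.X) (toSpecOver A₀.X ≫ (x ≫ ψ))).left) =
            detClass (HasRank.isFiniteLocallyFree' hx1) := by
          rw [hkey x, hcl]; exact (detClass_pullback _ hℒff).symm
        exact eq_of_detClass_pullback_sliceAt_eq A₀ hΘ hP1 eP _ _ (h1.trans (hφ₀ x))
    exact ⟨Γ, φ₀, hΓ, hΓφ, hiff⟩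
  obtain ⟨Γ, φ₀, hΓ, hΓφ, hiff⟩ := hgraph
  -- S5 + S7: the unique morphism with the graph property (★ `existsUnique_hom_forall_comp_eq_of_isClosed`)
  obtain ⟨ψ, hψ, huniq⟩ := existsUnique_hom_forall_comp_eq_of_isClosed (T := T') (P := (A₀.dualOf Θ hΘ).X)
    hTn Γ hΓ φ₀ hΓφ
  refine ⟨⟨ψ.left, Over.w ψ⟩, (hiff ψ).1 hψ, ?_⟩
  rintro ⟨g, hg⟩ hgP
  have hψ' : (∀ x : AlgPoints T' ℂ, x ≫ Over.homMk g hg = φ₀ x) :=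
    (hiff (Over.homMk g hg : T' ⟶ (A₀.dualOf Θ hΘ).X)).2 hgP
  have := huniq (Over.homMk g hg) hψ'
  exact Subtype.ext (congrArg CommaMorphism.left this)

end AbelianVariety

end Literature.AlgebraicGeometry.Motives

end
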